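import Literature.NumberTheory.PAdicHodge.BdRPlusTopology
import Literature.NumberTheory.PAdicHodge.BdRPlusEmbedding
import HarnessLib

/-!
# The base field `F` as a discrete coefficient field for power-series evaluation in `B_dR⁺(F)`

Topic `Literature/NumberTheory/PAdicHodge`; sequel of `BdRPlusTopology` (§3 there: `ℚ` as a discrete coefficient ring
`RatCoeff` for `log_𝔉`, `exp_𝔉` of formal groups over `ℤ`) and `BdRPlusEmbedding` (the `Γ_F`-equivariant Hensel embedding
`embBdRHom : F ↪ B_dR⁺(F)`).

For formal groups over a RAMIFIED base `𝒪 = ℤ_p[ϖ] ⊆ F` (the good models over `𝒪_{ℚ_p(ϖ)}` of elliptic curves with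
potentially good reduction), the logarithm `log_𝔉` has coefficients in `F`, not in `ℚ`. This file provides the
corresponding evaluation layer:

* `FieldCoeff hp hF` — the type synonym of `F` with the DISCRETE uniformity (the surjectivity witness `hF` of Fontaine's
  `θ`, on which `embBdRHom` depends, is baked into the type — as `PadicBase F p hp` bakes `hp` — so that the algebra
  structure below is a global instance on the new type);
* `Algebra (FieldCoeff hp hF) (BdRPlusTop F p)` through `embBdRHom`, with continuous (discrete) scalar action;
* `FieldCoeff.galAlgHom σ` — `σ ∈ Γ_F` as a `FieldCoeff`-ALGEBRA endomorphism of `B_dR⁺` (`σ ∘ embBdRHom = embBdRHom`,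
  tree `galBdRPlus_embBdRHom`), whence **`σ(f(x)) = f(σ x)`** for `f ∈ F⟦X⟧` and topologically nilpotent `x`
  (`gal_aeval`, `gal_evalPt`, `gal_evalPt₁`) — the equivariance of `F`-linear period integrals such as `log_𝔉`.

Definitions (reviewed): `FieldCoeff`, `FieldCoeff.of`, `FieldCoeff.galAlgHom`, and the field / uniform / algebra instances on
the NEW type `FieldCoeff hp hF`. No named facts, no `sorry`. Infrastructure for hDR over a ramified base; nothing about
elliptic curves is proved here.

## References
* J.-M. Fontaine, *Le corps des périodes p-adiques*, Astérisque 223 (1994), Exp. II §1.5.3–1.5.4 (`P̄ ⊆ B_dR⁺`, `t = log[ε]`).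
  [FontaineAsterisque223III]
* J.-P. Serre, *Local class field theory* (Cassels–Fröhlich Ch. VI) §3.2. [CasselsFrohlichANT1967]
-/

noncomputable section

open Ideal Field WittVector MvPowerSeries ValuativeRel

namespace Literature.NumberTheory.PAdicHodge

open Literature.NumberTheory.GaloisRepresentations
open Literature.NumberTheory.GaloisRepresentations.IsNonarchimedeanLocalField
open Literature.NumberTheory.GaloisRepresentations.LubinTate

variable {F : Type} [Field F] [ValuativeRel F] [TopologicalSpace F] [IsNonarchimedeanLocalField F] [CharZero F]
  {p : ℕ} [Fact p.Prime] [Fact (¬ IsUnit (p : integerC F))] [IsAdicComplete (Ideal.span {(p : integerC F)}) (integerC F)]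

/-- **`F` as a DISCRETE coefficient field** for power-series evaluation in `B_dR⁺(F)` (embedded by `embBdRHom hp hF`).
[cite: FontaineAsterisque223III, Exp. II §1.5.3] -/
def FieldCoeff (_hp : valuation F p < 1) (_hF : Function.Surjective (fontaineTheta (integerC F) p)) : Type := F

namespace FieldCoeff

variable {hp : valuation F p < 1} {hF : Function.Surjective (fontaineTheta (integerC F) p)}

/-- Field structure (that of `F`). [folklore] -/
instance : Field (FieldCoeff hp hF) := inferInstanceAs (Field F)
/-- Characteristic zero (that of `F`). [folklore] -/
instance : CharZero (FieldCoeff hp hF) := inferInstanceAs (CharZero F)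
/-- The discrete uniformity on the coefficient field. [folklore] -/
instance : UniformSpace (FieldCoeff hp hF) := ⊥
/-- The coefficient field is discretely uniformised. [folklore] -/
instance : DiscreteUniformity (FieldCoeff hp hF) := ⟨rfl⟩
/-- … hence discrete. [folklore] -/
instance : DiscreteTopology (FieldCoeff hp hF) := inferInstance

variable (hp hF) in
/-- The identification `F = FieldCoeff hp hF`. [folklore] -/
def of : F ≃+* FieldCoeff hp hF := RingEquiv.refl _

/-- **`B_dR⁺(F)` as an algebra over the discrete copy of `F`**, through the Hensel embedding `embBdRHom : F ↪ B_dR⁺`.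
[cite: FontaineAsterisque223III, Exp. II §1.5.3] -/
instance instAlgebra : Algebra (FieldCoeff hp hF) (BdRPlusTop F p) :=
  ((BdRPlusTop.of F p).toRingHom.comp ((embBdRHom hp hF).comp (of hp hF).symm.toRingHom)).toAlgebra

/-- Unfolding the algebra map: `c ↦ embBdRHom c`. [cite: FontaineAsterisque223III, Exp. II §1.5.3] -/
theorem algebraMap_of (c : F) :
    algebraMap (FieldCoeff hp hF) (BdRPlusTop F p) (of hp hF c) = BdRPlusTop.of F p (embBdRHom hp hF c) := rfl

/-- The discrete coefficient field acts continuously on `B_dR⁺`. [folklore] -/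
instance : ContinuousSMul (FieldCoeff hp hF) (BdRPlusTop F p) := by
  refine ⟨continuous_prod_of_discrete_left.mpr fun a => ?_⟩
  change Continuous fun s : BdRPlusTop F p => algebraMap (FieldCoeff hp hF) (BdRPlusTop F p) a * s
  exact continuous_const_mul _

/-- **`Γ_F` fixes the coefficients**: `σ(c · 1) = c · 1` for `c ∈ F` (tree `galBdRPlus_embBdRHom`).
[cite: FontaineAsterisque223III, Exp. II §1.5.3] -/
theorem gal_algebraMap (σ : absoluteGaloisGroup F) (c : FieldCoeff hp hF) :
    BdRPlusTop.gal F p σ (algebraMap (FieldCoeff hp hF) (BdRPlusTop F p) c) = algebraMap (FieldCoeff hp hF) (BdRPlusTop F p) c := by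
  obtain ⟨c, rfl⟩ := (of hp hF).surjective c
  rw [algebraMap_of, BdRPlusTop.gal_of, galBdRPlus_embBdRHom]

/-- `σ ∈ Γ_F` as a `FieldCoeff`-algebra endomorphism of `B_dR⁺`. [cite: FontaineAsterisque223III, Exp. II §1.5.3] -/
def galAlgHom (σ : absoluteGaloisGroup F) : BdRPlusTop F p →ₐ[FieldCoeff hp hF] BdRPlusTop F p :=
  { BdRPlusTop.gal F p σ with commutes' := gal_algebraMap σ }

/-- Unfolding `galAlgHom`. [cite: FontaineAsterisque223III, Exp. II §1.5] -/
@[simp] theorem galAlgHom_apply (σ : absoluteGaloisGroup F) (x : BdRPlusTop F p) :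
    galAlgHom (hp := hp) (hF := hF) σ x = BdRPlusTop.gal F p σ x := rfl

/-- **`Γ_F` commutes with evaluation**: `σ(f(x)) = f(σ x)` for `f ∈ F⟦X⟧` and a topologically nilpotent family `x` in
`B_dR⁺` (Mathlib `MvPowerSeries.comp_aeval`; `σ` continuous and `F`-linear). [cite: FontaineAsterisque223III, Exp. II §1.5.4] -/
theorem gal_aeval (σ : absoluteGaloisGroup F) {ι : Type*} {x : ι → BdRPlusTop F p} (hx : HasEval x)
    (f : MvPowerSeries ι (FieldCoeff hp hF)) :
    BdRPlusTop.gal F p σ (aeval hx f) =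
      aeval (hx.map (φ := ((galAlgHom (hp := hp) (hF := hF) σ : BdRPlusTop F p →ₐ[FieldCoeff hp hF] BdRPlusTop F p) :
        BdRPlusTop F p →+* BdRPlusTop F p)) (BdRPlusTop.continuous_gal (F := F) (p := p) σ)) f := by
  have h := MvPowerSeries.comp_aeval hx (ε := galAlgHom (hp := hp) (hF := hF) σ) (BdRPlusTop.continuous_gal (F := F) (p := p) σ)
  exact AlgHom.congr_fun h f

/-- `aeval` at equal point families. [cite: CasselsFrohlichANT1967, Ch. VI §3.2] -/
theorem aeval_congr_point {σ' : Type*} {a b : σ' → BdRPlusTop F p} (ha : HasEval a) (hb : HasEval b)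
    (h : a = b) (f : MvPowerSeries σ' (FieldCoeff hp hF)) : aeval ha f = aeval hb f := by
  subst h; rfl

/-- **`σ(f(x)) = f(σ x)` on points of `Fil¹`.** [cite: FontaineAsterisque223III, Exp. II §1.5.4] -/
theorem gal_evalPt (σ : absoluteGaloisGroup F) {ι : Type*} [Finite ι] (f : MvPowerSeries ι (FieldCoeff hp hF))
    (hf : f.constantCoeff = 0) (x y : ι → (BdRPlusTop.filOne F p).toIdeal)
    (hxy : ∀ i, BdRPlusTop.gal F p σ (x i : BdRPlusTop F p) = y i) :
    BdRPlusTop.gal F p σ (evalPt (BdRPlusTop.filOne F p) f hf x : BdRPlusTop F p) =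
      (evalPt (BdRPlusTop.filOne F p) f hf y : BdRPlusTop F p) := by
  rw [coe_evalPt, coe_evalPt, gal_aeval σ ((BdRPlusTop.filOne F p).hasEval x) f]
  exact aeval_congr_point _ _ (funext fun i => hxy i) f

/-- **`σ(f(x)) = f(σ x)` for one-variable evaluation on `Fil¹`** — e.g. `σ(log_𝔉(x)) = log_𝔉(σ x)` for a formal group over
`𝒪 ⊆ F`: the equivariance of the ω-period over a ramified base. [cite: FontaineAsterisque223III, Exp. II §1.5.4] -/
theorem gal_evalPt₁ (σ : absoluteGaloisGroup F) (f : PowerSeries (FieldCoeff hp hF)) (hf : PowerSeries.constantCoeff f = 0)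
    (x : (BdRPlusTop.filOne F p).toIdeal) :
    BdRPlusTop.gal F p σ (evalPt₁ (BdRPlusTop.filOne F p) f hf x : BdRPlusTop F p) =
      (evalPt₁ (BdRPlusTop.filOne F p) f hf ⟨BdRPlusTop.gal F p σ x, BdRPlusTop.gal_mem_filOne σ x.2⟩ : BdRPlusTop F p) :=
  gal_evalPt σ (ι := Unit) f hf (fun _ => x) (fun _ => ⟨BdRPlusTop.gal F p σ x, BdRPlusTop.gal_mem_filOne σ x.2⟩) fun _ => rfl

end FieldCoeff

end Literature.NumberTheory.PAdicHodge

end
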